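import Mathlib.LinearAlgebra.Matrix.GeneralLinearGroup.Card
import Literature.IUT.LogVolume.GenuineRamificationBounds
import Literature.IUT.LogVolume.ThetaFieldReadingClosure
import Literature.IUT.LogVolume.GenuineTowerFacts
import Literature.IUT.LogVolume.GenuineLogThetaPointNecessity
import Literature.IUT.LogVolume.LocalDegreeGlobalBounds
import HarnessLib

/-!
# Absolute degree bounds for the tower `ℚ ⊆ F_tpd ⊆ F ⊆ K` of a genuine Θ-volume datum
# ([IUTchIV] Thm. 1.10, proof, Step (ii): "`Gal(K/F) ↪ GL₂(𝔽_l)`", "`Gal(F/F_tpd) ↪ GL₂(𝔽₃) × GL₂(𝔽₅) × ℤ/2ℤ`")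

Mochizuki, *Inter-universal Teichmüller theory IV*, RIMS manuscript (Apr. 2020; = PRIMS **57** (2021)), proof of
Thm. 1.10, p. 24 (read on the page): "(E3) For `p` a prime number, the cardinality `|GL₂(𝔽_p)|` of `GL₂(𝔽_p)` is given by
`|GL₂(𝔽_p)| = p(p+1)(p−1)²`"; Step (ii), p. 24 l. 18–21: "we have a natural outer inclusion `Gal(F/F_tpd) ↪ GL₂(𝔽₃) ×
GL₂(𝔽₅) × ℤ/2ℤ`", "since the extension `K/F` is tamely ramified at the primes that do not divide `l`, and we have a
natural outer inclusion `Gal(K/F) ↪ GL₂(𝔽_l)`"; [IUTchI] Def. 3.1 (c) p. 61 ("`K ⊆ F̄` … the finite Galois extension of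
`F` determined by the kernel of this homomorphism [`G_F → GL₂(𝔽_l)`]").

PROOF-ONLY companion (cell `abc-iut`, seat abc-iut-w5-d194 gen 5; brick **(H1)** of abc-iut-C-cert-1's HEX-KERNEL
sizing, STATUS 2026-08-26T10:57:55Z) of abc-iut-S2's `GenuineLogThetaPoint.lean` and of `GenuineTowerFacts.lean`.
No definition, no new `Prop`, no new named fact.  For EVERY genuine Θ-volume datum `T : Cor22.ThetaVolumeDatumAt P l`
(no side hypothesis: `λ ∈ U_X` is read off the datum by abc-iut-f-198's `ThetaVolumeDatumAt.inU`, `l` prime by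
[IUTchI] Def. 3.1 (c)) the divisibilities of `ThetaVolumeDatumAt.towerFacts` are turned into the INEQUALITIES the
sizing consumes:

* `finrank_F_K_dvd_card_GL₂`, `finrank_F_K_le_card_GL₂`, `finrank_F_K_le_pow_four` — `[K : F] ∣ l(l−1)²(l+1)`,
  hence `[K : F] ≤ l(l−1)²(l+1) ≤ l⁴`; and `card_GL_two_zmod : Nat.card (GL (Fin 2) (ZMod l)) = l(l−1)²(l+1)` (print's
  (E3), via Mathlib's `Matrix.card_GL_field`), so that the bound reads literally `[K : F] ≤ |GL₂(𝔽_l)|`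
  (`finrank_F_K_le_natCard_GL`);
* `finrank_tpd_F_le` — `[F : F_tpd] ≤ 2¹²·3²·5 = 184320` (the cell's reading v3 `F ⊆ F‡(P) = F_tpd(√−1, √λ, √(λ−1),
  E_λ[3·5])`, abc-iut's `finrank_thetaClosureField_dvd`; print's `F = F_tpd(√−1, E_{F_tpd}[3·5])` sits inside);
* `finrank_rat_F_le`, `finrank_rat_K_le` — the absolute degrees: `[F : ℚ] ≤ 184320·[F_tpd : ℚ]` and
  `[K : ℚ] ≤ 184320·[F_tpd : ℚ]·l⁴` (`[F_tpd : ℚ] = P.degree`), by the tower law; at a rational point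
  `P = ratPoint q` (`degree_ratPoint`): `[K : ℚ] ≤ 184320·l⁴` (`finrank_rat_K_le_ratPoint`);
* `ramificationIdx_int_le_of_datum` — hence `e(u | p) ≤ [K : ℚ] ≤ 184320·[F_tpd : ℚ]·l⁴` for every finite place `u`
  of `K` (abc-iut-S1's `ramificationIdx_int_le_finrank_rat`), `≤ 184320·l⁴` at a rational point.

Classical algebraic number theory over the tree's typed definitions (inputs BY NAME: `towerFacts`, `inU`,
`degree_ratPoint`, Mathlib `Module.finrank_mul_finrank`, `Matrix.card_GL_field`); nothing here constructs a
datum, asserts [IUTchIII] Cor. 3.12, or takes a side.  [cite: Mochizuki2012, IUTchIV Thm. 1.10 proof Step (ii) p. 24]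
[cite: Mochizuki2012, IUTchI Def. 3.1 (c) p. 61] [claim: Mochizuki2012, status: disputed] for every IUT quotation.
-/

noncomputable section

open scoped Classical

namespace Literature.IUT.LogVolume

namespace Cor22

namespace ThetaVolumeDatumAt

open NumberField Literature.NumberTheory.DiophantineGeometry.GenEll Literature.IUT.HodgeTheaters

variable {P : NFPoint} {l : ℕ} (T : ThetaVolumeDatumAt P l)

/-! ## The order of `GL₂(𝔽_l)` -/

/-- **(E3)** "For `p` a prime number, … `|GL₂(𝔽_p)| = p(p+1)(p−1)²`": `|GL₂(𝔽_l)| = (l²−1)(l²−l) = l(l−1)²(l+1)` for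
a prime `l` (Mathlib's `Matrix.card_GL_field` at `n = 2`, `𝔽 = ZMod l`). [cite: Mochizuki2012, IUTchIV Thm. 1.10 proof (E3) p. 24] -/
theorem card_GL_two_zmod (hl : l.Prime) : Nat.card (GL (Fin 2) (ZMod l)) = l * (l - 1) ^ 2 * (l + 1) := by
  haveI : Fact l.Prime := ⟨hl⟩
  rw [Matrix.card_GL_field, ZMod.card, Fin.prod_univ_two]
  obtain ⟨m, rfl⟩ : ∃ m, l = m + 1 := ⟨l - 1, (Nat.sub_add_cancel hl.one_le).symm⟩
  simp only [Fin.val_zero, Fin.val_one, pow_zero, pow_one, Nat.add_sub_cancel]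
  have h1 : (m + 1) ^ 2 - 1 = m * (m + 2) := Nat.sub_eq_of_eq_add (by ring)
  have h2 : (m + 1) ^ 2 - (m + 1) = (m + 1) * m := Nat.sub_eq_of_eq_add (by ring)
  rw [h1, h2]
  ring

/-! ## `[K : F]` -/

/-- **`[K : F] ∣ |GL₂(𝔽_l)| = l(l−1)²(l+1)`** for every genuine Θ-volume datum ([IUTchIV] Thm. 1.10 Step (ii) p. 24,
"`Gal(K/F) ↪ GL₂(𝔽_l)`"; [IUTchI] Def. 3.1 (c): `K` is cut out by the kernel of `G_F → GL₂(𝔽_l)`), with NO side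
hypothesis — `λ ∈ U_X` is `T.inU`. (The fifth component of `towerFacts`.)
[cite: Mochizuki2012, IUTchIV Thm. 1.10 proof Step (ii) p. 24] -/
theorem finrank_F_K_dvd_card_GL₂ :
    (letI := T.instFieldF; letI := T.instFieldK; letI := T.instAlgebraK
     Module.finrank T.F T.K) ∣ l * (l - 1) ^ 2 * (l + 1) := by
  letI := T.instFieldF; letI := T.instNumberFieldF; letI := T.instAlgebraF; letI := T.instFieldK
  letI := T.instNumberFieldK; letI := T.instAlgebraK; letI := T.instFieldFbar; letI := T.instAlgebraFbar
  letI := T.instAlgebraKFbar; letI := T.instIsElliptic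
  exact (T.towerFacts T.inU).2.2.2.2.1

/-- `l(l−1)²(l+1) > 0` for a prime `l`. [cite: Mochizuki2012, IUTchI Def. 3.1 (c) p. 61] -/
theorem card_GL₂_pos (hl : l.Prime) : 0 < l * (l - 1) ^ 2 * (l + 1) := by
  have h2 : 2 ≤ l := hl.two_le
  have h1 : 0 < l - 1 := by omega
  positivity

/-- **`[K : F] ≤ l(l−1)²(l+1)`** for every genuine Θ-volume datum. [cite: Mochizuki2012, IUTchIV Thm. 1.10 proof Step (ii) p. 24] -/
theorem finrank_F_K_le_card_GL₂ :
    (letI := T.instFieldF; letI := T.instFieldK; letI := T.instAlgebraK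
     Module.finrank T.F T.K) ≤ l * (l - 1) ^ 2 * (l + 1) := by
  letI := T.instFieldF; letI := T.instNumberFieldF; letI := T.instAlgebraF; letI := T.instFieldK
  letI := T.instNumberFieldK; letI := T.instAlgebraK; letI := T.instFieldFbar; letI := T.instAlgebraFbar
  letI := T.instAlgebraKFbar; letI := T.instIsElliptic
  exact Nat.le_of_dvd (card_GL₂_pos T.D.l_prime) T.finrank_F_K_dvd_card_GL₂

/-- **`[K : F] ≤ |GL₂(𝔽_l)|`**, literally, for every genuine Θ-volume datum.
[cite: Mochizuki2012, IUTchIV Thm. 1.10 proof Step (ii) p. 24] -/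
theorem finrank_F_K_le_natCard_GL :
    (letI := T.instFieldF; letI := T.instFieldK; letI := T.instAlgebraK
     Module.finrank T.F T.K) ≤ Nat.card (GL (Fin 2) (ZMod l)) := by
  letI := T.instFieldF; letI := T.instNumberFieldF; letI := T.instAlgebraF; letI := T.instFieldK
  letI := T.instNumberFieldK; letI := T.instAlgebraK; letI := T.instFieldFbar; letI := T.instAlgebraFbar
  letI := T.instAlgebraKFbar; letI := T.instIsElliptic
  rw [card_GL_two_zmod T.D.l_prime]
  exact T.finrank_F_K_le_card_GL₂

/-- **`[K : F] ≤ l⁴`** for every genuine Θ-volume datum (the form the HEX-KERNEL sizing consumes; `l(l−1)²(l+1) ≤ l⁴`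
is abc-iut-S1's `card_GL_two_le_pow_four`). [cite: Mochizuki2012, IUTchIV Thm. 1.10 proof Step (ii) p. 24] -/
theorem finrank_F_K_le_pow_four :
    (letI := T.instFieldF; letI := T.instFieldK; letI := T.instAlgebraK
     Module.finrank T.F T.K) ≤ l ^ 4 :=
  T.finrank_F_K_le_card_GL₂.trans (card_GL_two_le_pow_four l)

/-! ## `[F : F_tpd]` -/

/-- **`[F : F_tpd] ∣ 2¹²·3²·5`** for every genuine Θ-volume datum ([IUTchIV] Thm. 1.10 Step (ii) p. 24 "`Gal(F/F_tpd) ↪ GL₂(𝔽₃) × GL₂(𝔽₅) × ℤ/2ℤ`", in the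
cell's reading v3 `F_tpd ⊆ F ⊆ F‡(P) = F_tpd(√−1, √λ, √(λ−1), E_λ[3·5])`), NO side hypothesis. (The fourth component
of `towerFacts`, `a = 12`.) [cite: Mochizuki2012, IUTchIV Thm. 1.10 proof Step (ii) p. 24] -/
theorem finrank_tpd_F_dvd :
    (letI := T.instFieldF; letI := T.instAlgebraF
     Module.finrank P.F T.F) ∣ 2 ^ 12 * 3 ^ 2 * 5 := by
  letI := T.instFieldF; letI := T.instNumberFieldF; letI := T.instAlgebraF; letI := T.instFieldK
  letI := T.instNumberFieldK; letI := T.instAlgebraK; letI := T.instFieldFbar; letI := T.instAlgebraFbar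
  letI := T.instAlgebraKFbar; letI := T.instIsElliptic
  haveI : Fact P.InU := ⟨T.inU⟩
  have h := (T.isSubThetaField.finrank_dvd (subThetaFieldGenerators_splits_thetaClosureField P T.inU)).trans
    (finrank_thetaClosureField_dvd P T.inU)
  norm_num at h ⊢
  exact h

/-- **`[F : F_tpd] ≤ 184320 = 2¹²·3²·5`** for every genuine Θ-volume datum, with NO side hypothesis (the tree's
`ThetaVolumeDatumAt.finrank_le`, `ThetaFieldReadingClosure.lean`, at `hU := T.inU`, its literal `2²·46080` normalised).
[cite: Mochizuki2012, IUTchIV Thm. 1.10 proof Step (ii) p. 24] -/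
theorem finrank_tpd_F_le :
    (letI := T.instFieldF; letI := T.instAlgebraF
     Module.finrank P.F T.F) ≤ 184320 := by
  have h := T.finrank_le T.inU
  norm_num at h
  exact h

/-! ## Absolute degrees, by the tower law -/

/-- **`[F : ℚ] ≤ 184320 · [F_tpd : ℚ]`** for every genuine Θ-volume datum (`[F_tpd : ℚ] = P.degree`).
[cite: Mochizuki2012, IUTchIV Thm. 1.10 proof Step (ii) p. 24] -/
theorem finrank_rat_F_le :
    (letI := T.instFieldF; letI := T.instNumberFieldF
     Module.finrank ℚ T.F) ≤ 184320 * P.degree := by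
  letI := T.instFieldF; letI := T.instNumberFieldF; letI := T.instAlgebraF; letI := T.instFieldK
  letI := T.instNumberFieldK; letI := T.instAlgebraK; letI := T.instFieldFbar; letI := T.instAlgebraFbar
  letI := T.instAlgebraKFbar; letI := T.instIsElliptic
  have htower : Module.finrank ℚ P.F * Module.finrank P.F T.F = Module.finrank ℚ T.F :=
    Module.finrank_mul_finrank ℚ P.F T.F
  rw [← htower, NFPoint.degree, mul_comm (Module.finrank ℚ P.F)]
  exact Nat.mul_le_mul_right _ T.finrank_tpd_F_le

/-- **`[K : ℚ] ≤ 184320 · [F_tpd : ℚ] · l⁴`** for every genuine Θ-volume datum — the absolute degree bound of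
the `l`-division tower `ℚ ⊆ F_tpd ⊆ F ⊆ K = F(E_F[l])` ([IUTchIV] Thm. 1.10 Step (ii)).
[cite: Mochizuki2012, IUTchIV Thm. 1.10 proof Step (ii) p. 24] -/
theorem finrank_rat_K_le :
    (letI := T.instFieldK; letI := T.instNumberFieldK
     Module.finrank ℚ T.K) ≤ 184320 * P.degree * l ^ 4 := by
  letI := T.instFieldF; letI := T.instNumberFieldF; letI := T.instAlgebraF; letI := T.instFieldK
  letI := T.instNumberFieldK; letI := T.instAlgebraK; letI := T.instFieldFbar; letI := T.instAlgebraFbar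
  letI := T.instAlgebraKFbar; letI := T.instIsElliptic
  have htower : Module.finrank ℚ T.F * Module.finrank T.F T.K = Module.finrank ℚ T.K :=
    Module.finrank_mul_finrank ℚ T.F T.K
  rw [← htower]
  exact Nat.mul_le_mul T.finrank_rat_F_le T.finrank_F_K_le_pow_four

/-- The same with the exact factor `l(l−1)²(l+1) = |GL₂(𝔽_l)|`: `[K : ℚ] ≤ 184320 · [F_tpd : ℚ] · l(l−1)²(l+1)`.
[cite: Mochizuki2012, IUTchIV Thm. 1.10 proof Step (ii) p. 24] -/
theorem finrank_rat_K_le_card_GL₂ :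
    (letI := T.instFieldK; letI := T.instNumberFieldK
     Module.finrank ℚ T.K) ≤ 184320 * P.degree * (l * (l - 1) ^ 2 * (l + 1)) := by
  letI := T.instFieldF; letI := T.instNumberFieldF; letI := T.instAlgebraF; letI := T.instFieldK
  letI := T.instNumberFieldK; letI := T.instAlgebraK; letI := T.instFieldFbar; letI := T.instAlgebraFbar
  letI := T.instAlgebraKFbar; letI := T.instIsElliptic
  have htower : Module.finrank ℚ T.F * Module.finrank T.F T.K = Module.finrank ℚ T.K :=
    Module.finrank_mul_finrank ℚ T.F T.K
  rw [← htower]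
  exact Nat.mul_le_mul T.finrank_rat_F_le T.finrank_F_K_le_card_GL₂

/-- **At a rational point** `P = ratPoint q` (`F_tpd = ℚ`, `degree_ratPoint`): `[K : ℚ] ≤ 184320 · l⁴` for every
genuine Θ-volume datum — the constant of the HEX-KERNEL sizing at the tree's witness family `λ_k = 1/2 + 2/7^k`.
[cite: Mochizuki2012, IUTchIV Thm. 1.10 proof Step (ii) p. 24] -/
theorem finrank_rat_K_le_ratPoint {q : ℚ} {l : ℕ} (T : ThetaVolumeDatumAt (ratPoint q) l) :
    (letI := T.instFieldK; letI := T.instNumberFieldK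
     Module.finrank ℚ T.K) ≤ 184320 * l ^ 4 := by
  have h := T.finrank_rat_K_le
  rw [degree_ratPoint, mul_one] at h
  exact h

/-- **At a rational point**, `[F : ℚ] ≤ 184320`. [cite: Mochizuki2012, IUTchIV Thm. 1.10 proof Step (ii) p. 24] -/
theorem finrank_rat_F_le_ratPoint {q : ℚ} {l : ℕ} (T : ThetaVolumeDatumAt (ratPoint q) l) :
    (letI := T.instFieldF; letI := T.instNumberFieldF
     Module.finrank ℚ T.F) ≤ 184320 := by
  have h := T.finrank_rat_F_le
  rw [degree_ratPoint, mul_one] at h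
  exact h

/-! ## Consequence for ramification indices (with abc-iut-S1's `ramificationIdx_int_le_finrank_rat`) -/

/-- **`e(u | p) ≤ 184320 · [F_tpd : ℚ] · l⁴` for EVERY finite place `u` of the `l`-division field `K`** of a genuine
Θ-volume datum: the absolute ramification index is at most the absolute degree (`e(u|p) ≤ [K : ℚ]`, the tree's
`ramificationIdx_int_le_finrank_rat`), bounded by `finrank_rat_K_le`. (The crude uniform form; the sharp per-layer
budget `e ≤ e*_mod·l` of [IUTchIV] Thm. 1.10 Step (iii) (R1)–(R3) is `GenuineRamificationBoundsTower.lean`.)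
[cite: Mochizuki2012, IUTchIV Thm. 1.10 proof Step (ii) p. 24] [cite: NeukirchANT1999, Ch. I Prop. (8.2)] -/
theorem ramificationIdx_int_le_of_datum
    (u : letI := T.instFieldK; letI := T.instNumberFieldK; IsDedekindDomain.HeightOneSpectrum (𝓞 T.K)) :
    (letI := T.instFieldK; letI := T.instNumberFieldK
     u.asIdeal.ramificationIdx ℤ) ≤ 184320 * P.degree * l ^ 4 := by
  letI := T.instFieldF; letI := T.instNumberFieldF; letI := T.instAlgebraF; letI := T.instFieldK
  letI := T.instNumberFieldK; letI := T.instAlgebraK; letI := T.instFieldFbar; letI := T.instAlgebraFbar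
  letI := T.instAlgebraKFbar; letI := T.instIsElliptic
  exact (ramificationIdx_int_le_finrank_rat u).trans T.finrank_rat_K_le

/-- At a rational point: `e(u | p) ≤ 184320 · l⁴` for every finite place `u` of `K`.
[cite: Mochizuki2012, IUTchIV Thm. 1.10 proof Step (ii) p. 24] [cite: NeukirchANT1999, Ch. I Prop. (8.2)] -/
theorem ramificationIdx_int_le_of_datum_ratPoint {q : ℚ} {l : ℕ} (T : ThetaVolumeDatumAt (ratPoint q) l)
    (u : letI := T.instFieldK; letI := T.instNumberFieldK; IsDedekindDomain.HeightOneSpectrum (𝓞 T.K)) :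
    (letI := T.instFieldK; letI := T.instNumberFieldK
     u.asIdeal.ramificationIdx ℤ) ≤ 184320 * l ^ 4 := by
  have h := T.ramificationIdx_int_le_of_datum u
  rw [degree_ratPoint, mul_one] at h
  exact h

end ThetaVolumeDatumAt

end Cor22

end Literature.IUT.LogVolume

/-!
## v2 (appended 2026-08-26, same seat): the substitution slots for the HEX-KERNEL assembly

The real-cast and `log_b` forms of `finrank_rat_K_le` (the `hN : ([K:ℚ] : ℝ) ≤ N` slot of abc-iut-w6-d105's
`depthConstants_rescaledCompletion_lt_of_finrank_le`, `LocalDegreeGlobalBounds.lean`), and the composite at every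
completion of the `l`-division field of a datum: `d(K_u) + a(K_u) + b(K_u) < 4 + 2·log_p(184320·[F_tpd : ℚ]·l⁴)` for `p > 2`
([IUTchIV] Prop. 1.2 constants `d, a, b` of `RamificationInvariants.lean`; Lenstra's different bound via w6-d105's file),
`< 4 + 2·log_p(184320·l⁴)` at a rational point. Proof-only; inputs BY NAME. [cite: Mochizuki2012, IUTchIV Thm. 1.10 proof Step (ii) p. 24]
-/

namespace Literature.IUT.LogVolume

namespace Cor22

namespace ThetaVolumeDatumAt

open NumberField IsDedekindDomain Literature.NumberTheory.DiophantineGeometry.GenEll Literature.IUT.HodgeTheaters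
open Literature.NumberTheory.NumberFields

variable {P : NFPoint} {l : ℕ} (T : ThetaVolumeDatumAt P l)

/-- **`([K : ℚ] : ℝ) ≤ 184320 · [F_tpd : ℚ] · l⁴`** — `finrank_rat_K_le` cast to `ℝ` (the `hN` slot of
`depthConstants_rescaledCompletion_lt_of_finrank_le`). [cite: Mochizuki2012, IUTchIV Thm. 1.10 proof Step (ii) p. 24] -/
theorem finrank_rat_K_cast_le :
    (letI := T.instFieldK; letI := T.instNumberFieldK
     ((Module.finrank ℚ T.K : ℕ) : ℝ)) ≤ 184320 * (P.degree : ℝ) * (l : ℝ) ^ 4 := by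
  have h := T.finrank_rat_K_le
  exact_mod_cast h

/-- At a rational point: `([K : ℚ] : ℝ) ≤ 184320 · l⁴`. [cite: Mochizuki2012, IUTchIV Thm. 1.10 proof Step (ii) p. 24] -/
theorem finrank_rat_K_cast_le_ratPoint {q : ℚ} {l : ℕ} (T : ThetaVolumeDatumAt (ratPoint q) l) :
    (letI := T.instFieldK; letI := T.instNumberFieldK
     ((Module.finrank ℚ T.K : ℕ) : ℝ)) ≤ 184320 * (l : ℝ) ^ 4 := by
  have h := T.finrank_rat_K_le_ratPoint
  exact_mod_cast h

/-- **`log_b [K : ℚ] ≤ log_b (184320 · [F_tpd : ℚ] · l⁴)`** for any base `b > 1` (monotonicity of `Real.logb`; `[K : ℚ] ≥ 1`).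
[cite: Mochizuki2012, IUTchIV Thm. 1.10 proof Step (ii) p. 24] -/
theorem logb_finrank_rat_K_le {b : ℝ} (hb : 1 < b) :
    (letI := T.instFieldK; letI := T.instNumberFieldK
     Real.logb b (Module.finrank ℚ T.K)) ≤ Real.logb b (184320 * (P.degree : ℝ) * (l : ℝ) ^ 4) := by
  letI := T.instFieldK; letI := T.instNumberFieldK
  have hpos : (0 : ℝ) < (Module.finrank ℚ T.K : ℕ) := by exact_mod_cast Module.finrank_pos
  exact Real.logb_le_logb_of_le hb hpos T.finrank_rat_K_cast_le

/-- At a rational point: `log_b [K : ℚ] ≤ log_b (184320 · l⁴)` for `b > 1`. [cite: Mochizuki2012, IUTchIV Thm. 1.10 proof Step (ii) p. 24] -/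
theorem logb_finrank_rat_K_le_ratPoint {q : ℚ} {l : ℕ} (T : ThetaVolumeDatumAt (ratPoint q) l) {b : ℝ} (hb : 1 < b) :
    (letI := T.instFieldK; letI := T.instNumberFieldK
     Real.logb b (Module.finrank ℚ T.K)) ≤ Real.logb b (184320 * (l : ℝ) ^ 4) := by
  have h := T.logb_finrank_rat_K_le hb
  rw [degree_ratPoint, Nat.cast_one, mul_one] at h
  exact h

/-- **`d(K_u) + a(K_u) + b(K_u) < 4 + 2·log_p(184320 · [F_tpd : ℚ] · l⁴)`** for `p > 2`, at EVERY finite place `u ∣ p` of the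
`l`-division field `K` of a genuine Θ-volume datum, for the [IUTchIV] Prop. 1.2 constants of the rescaled completion `K_u`
(abc-iut-S7's `RescaledCompletion`): abc-iut-w6-d105's `depthConstants_rescaledCompletion_lt_of_finrank_le` with the slot
`N := 184320·[F_tpd : ℚ]·l⁴` filled by `finrank_rat_K_cast_le` — no datum-opaque quantity remains on the right.
[cite: Mochizuki2012, IUTchIV Prop. 1.2 p. 10] [cite: Mochizuki2012, IUTchIV Thm. 1.10 proof Step (ii) p. 24] -/
theorem depthConstants_completion_lt (p : ℕ) [Fact p.Prime] (hp : 2 < p)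
    (u : letI := T.instFieldK; letI := T.instNumberFieldK; HeightOneSpectrum (𝓞 T.K))
    (hu : letI := T.instFieldK; letI := T.instNumberFieldK; ((p : ℕ) : 𝓞 T.K) ∈ u.asIdeal) :
    (letI := T.instFieldK; letI := T.instNumberFieldK
     differentOrd p (RescaledCompletion T.K p u hu)
        + logRadiusA p (absRamificationIdx p (RescaledCompletion T.K p u hu))
        + logRadiusB p (absRamificationIdx p (RescaledCompletion T.K p u hu))) <
      4 + 2 * Real.logb p (184320 * (P.degree : ℝ) * (l : ℝ) ^ 4) := by
  letI := T.instFieldK; letI := T.instNumberFieldK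
  exact depthConstants_rescaledCompletion_lt_of_finrank_le T.K p u hu hp T.finrank_rat_K_cast_le

/-- At a rational point: `d(K_u) + a(K_u) + b(K_u) < 4 + 2·log_p(184320 · l⁴)` for `p > 2` at every finite place `u ∣ p` of `K`
— the constant of the HEX-KERNEL sizing on the family `λ_k = 1/2 + 2/7^k`. [cite: Mochizuki2012, IUTchIV Prop. 1.2 p. 10]
[cite: Mochizuki2012, IUTchIV Thm. 1.10 proof Step (ii) p. 24] -/
theorem depthConstants_completion_lt_ratPoint {q : ℚ} {l : ℕ} (T : ThetaVolumeDatumAt (ratPoint q) l)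
    (p : ℕ) [Fact p.Prime] (hp : 2 < p)
    (u : letI := T.instFieldK; letI := T.instNumberFieldK; HeightOneSpectrum (𝓞 T.K))
    (hu : letI := T.instFieldK; letI := T.instNumberFieldK; ((p : ℕ) : 𝓞 T.K) ∈ u.asIdeal) :
    (letI := T.instFieldK; letI := T.instNumberFieldK
     differentOrd p (RescaledCompletion T.K p u hu)
        + logRadiusA p (absRamificationIdx p (RescaledCompletion T.K p u hu))
        + logRadiusB p (absRamificationIdx p (RescaledCompletion T.K p u hu))) <
      4 + 2 * Real.logb p (184320 * (l : ℝ) ^ 4) := by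
  letI := T.instFieldK; letI := T.instNumberFieldK
  exact depthConstants_rescaledCompletion_lt_of_finrank_le T.K p u hu hp T.finrank_rat_K_cast_le_ratPoint

end ThetaVolumeDatumAt

end Cor22

end Literature.IUT.LogVolume

end
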